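import Summits.QuantumFields.YangMills.Theses.SamplerStability

/-!
# Route `SamplerStability` (planner seat ym-idea-5 g9): the split glue `StabilityKernelGlue` (stmt-QuantumFields-28104) —
# `GapRateToWaist → WaistToLeaf → StabilityKernel`, modus ponens

Width seat ym-line-sfw-p2-w2 g20 (cell `ym-idea-1`, free hands).  No summit, rung or crux is proved here.
-/

namespace Summit.QuantumFields.YangMills.Theorems

open Summit.QuantumFields.YangMills.Theses.SamplerStability in
/-- The split glue of crux `StabilityKernel`: the waist currency (child 1) fed into the waist-to-leaf reduction (child 2). [folklore] -/
theorem samplerStability_stabilityKernelGlue_proof : Summit.QuantumFields.YangMills.Theses.SamplerStability.StabilityKernelGlue :=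
  fun h1 h2 F γ hγ hG hR => h2 F γ hγ (h1 F γ hγ hG hR)

end Summit.QuantumFields.YangMills.Theorems
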